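import Mathlib
import HarnessLib

/-!
# Iterated ("type II box") integrals over polytopes in `ℝ³`
# (integration toolkit for the secular peeling of Zhang–Jiang–Xie 2025, Prop. 6.10)

The elementary evaluation of the Hilbert–Schmidt volume of the two-qubit `λ_max ≤ ½` fibres
[ZhangJiangXie2025, Prop. 6.10] reduces (files `…SchurSection`, `…Secular`) to integrals of explicit
piecewise polynomials over polytopes in `ℝ³` (coordinates `e : Fin 3 → ℝ`).  This file provides the
generic, purely measure-theoretic glue used to evaluate them:

* `fin3Equiv`, `integral_fin3_eq_iterated` — `∫ over ℝ³ = ∫ de₂ ∫ de₁ ∫ de₀` (Fubini);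
* `boxRegion α β M₁ M₂ L U = {α < e₂ < β, M₁ e₂ < e₁ < M₂ e₂, L e₁ e₂ < e₀ < U e₁ e₂}` and
  `integral_boxRegion` — the integral of a continuous function over such a region is the iterated
  interval integral `∫_α^β ∫_{M₁}^{M₂} ∫_L^U`;
* `closedBoxRegion` and `volume_closedBoxRegion_diff` — the boundary is null (graphs of measurable
  functions are null), so open and closed boxes may be exchanged under the integral.

Everything is folklore calculus; no named facts.

## References

* [ZhangJiangXie2025] L. Zhang, X. Jiang, B. Xie, Quantum Inf. Comput. 25 (2025) 598–632 =
  arXiv:2507.02369, §6.2 Prop. 6.10.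
-/

noncomputable section

open _root_.MeasureTheory Set Real
open scoped ENNReal

namespace Literature.Probability.RandomMatrix

namespace ZhangJiangXie2025

/-! ## B1. `ℝ³` as an iterated product -/

/-- `(Fin 3 → ℝ) ≃ᵐ ℝ × (ℝ × ℝ)`, `e ↦ (e 0, (e 1, e 2))`. [folklore] -/
def fin3Equiv : (Fin 3 → ℝ) ≃ᵐ ℝ × (ℝ × ℝ) :=
  (MeasurableEquiv.piFinSuccAbove (fun _ : Fin 3 => ℝ) 0).trans
    (MeasurableEquiv.prodCongr (MeasurableEquiv.refl ℝ) MeasurableEquiv.finTwoArrow)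

/-- `fin3Equiv e = (e 0, (e 1, e 2))`. [folklore] -/
theorem fin3Equiv_apply (e : Fin 3 → ℝ) : fin3Equiv e = (e 0, (e 1, e 2)) := rfl

/-- `fin3Equiv.symm (t, (u, v)) = ![t, u, v]`. [folklore] -/
theorem fin3Equiv_symm_apply (t u v : ℝ) : fin3Equiv.symm (t, (u, v)) = ![t, u, v] := by
  apply fin3Equiv.injective
  rw [MeasurableEquiv.apply_symm_apply, fin3Equiv_apply]
  rfl

/-- `fin3Equiv` preserves Lebesgue measure. [folklore] -/
theorem measurePreserving_fin3Equiv : MeasurePreserving fin3Equiv volume volume := by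
  refine MeasurePreserving.trans (volume_preserving_piFinSuccAbove (fun _ : Fin 3 => ℝ) 0) ?_
  exact MeasurePreserving.prod (MeasurePreserving.id volume) (volume_preserving_finTwoArrow ℝ)

/-- **Fubini on `ℝ³`**: `∫ F = ∫ de₂ ∫ de₁ ∫ de₀ F(e₀, e₁, e₂)` for integrable `F`. [folklore] -/
theorem integral_fin3_eq_iterated (F : (Fin 3 → ℝ) → ℝ) (hF : Integrable F) :
    ∫ e, F e = ∫ v : ℝ, ∫ u : ℝ, ∫ t : ℝ, F ![t, u, v] := by
  have h1 : ∫ e, F e = ∫ p : ℝ × (ℝ × ℝ), F (fin3Equiv.symm p) := by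
    rw [← (measurePreserving_fin3Equiv.symm _).integral_comp fin3Equiv.symm.measurableEmbedding]
  have hG : Integrable (fun p : ℝ × (ℝ × ℝ) => F (fin3Equiv.symm p))
      ((volume : Measure ℝ).prod (volume : Measure (ℝ × ℝ))) := by
    rw [← Measure.volume_eq_prod]
    exact (measurePreserving_fin3Equiv.symm _).integrable_comp_emb
      fin3Equiv.symm.measurableEmbedding |>.mpr hF
  rw [h1, Measure.volume_eq_prod, integral_prod_symm _ hG]
  have hG2 : Integrable (fun q : ℝ × ℝ => ∫ t : ℝ, F (fin3Equiv.symm (t, q)))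
      ((volume : Measure ℝ).prod (volume : Measure ℝ)) := by
    rw [← Measure.volume_eq_prod]
    exact hG.integral_prod_right
  rw [Measure.volume_eq_prod, integral_prod_symm _ hG2]
  simp_rw [fin3Equiv_symm_apply]

/-- **Fubini on `ℝ³`, second nesting**: `∫ F = ∫ de₁ ∫ de₂ ∫ de₀ F(e₀, e₁, e₂)`. [folklore] -/
theorem integral_fin3_eq_iterated' (F : (Fin 3 → ℝ) → ℝ) (hF : Integrable F) :
    ∫ e, F e = ∫ u : ℝ, ∫ v : ℝ, ∫ t : ℝ, F ![t, u, v] := by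
  rw [integral_fin3_eq_iterated F hF]
  have hG : Integrable (fun p : ℝ × (ℝ × ℝ) => F (fin3Equiv.symm p))
      ((volume : Measure ℝ).prod (volume : Measure (ℝ × ℝ))) := by
    rw [← Measure.volume_eq_prod]
    exact (measurePreserving_fin3Equiv.symm _).integrable_comp_emb
      fin3Equiv.symm.measurableEmbedding |>.mpr hF
  have hG2 : Integrable (fun q : ℝ × ℝ => ∫ t : ℝ, F (fin3Equiv.symm (t, q)))
      ((volume : Measure ℝ).prod (volume : Measure ℝ)) := by
    rw [← Measure.volume_eq_prod]
    exact hG.integral_prod_right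
  have hG3 : Integrable (Function.uncurry fun (v u : ℝ) => ∫ t : ℝ, F ![t, u, v])
      ((volume : Measure ℝ).prod (volume : Measure ℝ)) := by
    have := hG2.swap
    refine this.congr (Filter.Eventually.of_forall fun q => ?_)
    obtain ⟨v, u⟩ := q
    simp only [Function.comp_apply, Prod.swap_prod_mk, Function.uncurry_apply_pair,
      fin3Equiv_symm_apply]
  exact integral_integral_swap hG3

/-! ## B2. Box regions and their iterated integrals -/

/-- The open "type II" region `{α < e₂ < β, M₁ e₂ < e₁ < M₂ e₂, L e₁ e₂ < e₀ < U e₁ e₂}`. [folklore] -/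
def boxRegion (α β : ℝ) (M₁ M₂ : ℝ → ℝ) (L U : ℝ → ℝ → ℝ) : Set (Fin 3 → ℝ) :=
  {e | α < e 2 ∧ e 2 < β ∧ M₁ (e 2) < e 1 ∧ e 1 < M₂ (e 2) ∧
    L (e 1) (e 2) < e 0 ∧ e 0 < U (e 1) (e 2)}

/-- The closed region `{α ≤ e₂ ≤ β, M₁ e₂ ≤ e₁ ≤ M₂ e₂, L e₁ e₂ ≤ e₀ ≤ U e₁ e₂}`. [folklore] -/
def closedBoxRegion (α β : ℝ) (M₁ M₂ : ℝ → ℝ) (L U : ℝ → ℝ → ℝ) : Set (Fin 3 → ℝ) :=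
  {e | α ≤ e 2 ∧ e 2 ≤ β ∧ M₁ (e 2) ≤ e 1 ∧ e 1 ≤ M₂ (e 2) ∧
    L (e 1) (e 2) ≤ e 0 ∧ e 0 ≤ U (e 1) (e 2)}

variable {α β : ℝ} {M₁ M₂ : ℝ → ℝ} {L U : ℝ → ℝ → ℝ}

/-- `boxRegion` is measurable (for continuous bounds). [folklore] -/
theorem measurableSet_boxRegion (hM₁ : Continuous M₁) (hM₂ : Continuous M₂)
    (hL : Continuous (Function.uncurry L)) (hU : Continuous (Function.uncurry U)) :
    MeasurableSet (boxRegion α β M₁ M₂ L U) := by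
  have m0 : Measurable fun e : Fin 3 → ℝ => e 0 := measurable_pi_apply 0
  have m1 : Measurable fun e : Fin 3 → ℝ => e 1 := measurable_pi_apply 1
  have m2 : Measurable fun e : Fin 3 → ℝ => e 2 := measurable_pi_apply 2
  have mL : Measurable fun e : Fin 3 → ℝ => L (e 1) (e 2) :=
    hL.measurable.comp (m1.prodMk m2)
  have mU : Measurable fun e : Fin 3 → ℝ => U (e 1) (e 2) :=
    hU.measurable.comp (m1.prodMk m2)
  unfold boxRegion
  refine (measurableSet_lt measurable_const m2).inter ((measurableSet_lt m2 measurable_const).inter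
    ((measurableSet_lt (hM₁.measurable.comp m2) m1).inter
    ((measurableSet_lt m1 (hM₂.measurable.comp m2)).inter
    ((measurableSet_lt mL m0).inter (measurableSet_lt m0 mU)))))

/-- `closedBoxRegion` is measurable (for continuous bounds). [folklore] -/
theorem measurableSet_closedBoxRegion (hM₁ : Continuous M₁) (hM₂ : Continuous M₂)
    (hL : Continuous (Function.uncurry L)) (hU : Continuous (Function.uncurry U)) :
    MeasurableSet (closedBoxRegion α β M₁ M₂ L U) := by
  have m0 : Measurable fun e : Fin 3 → ℝ => e 0 := measurable_pi_apply 0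
  have m1 : Measurable fun e : Fin 3 → ℝ => e 1 := measurable_pi_apply 1
  have m2 : Measurable fun e : Fin 3 → ℝ => e 2 := measurable_pi_apply 2
  have mL : Measurable fun e : Fin 3 → ℝ => L (e 1) (e 2) :=
    hL.measurable.comp (m1.prodMk m2)
  have mU : Measurable fun e : Fin 3 → ℝ => U (e 1) (e 2) :=
    hU.measurable.comp (m1.prodMk m2)
  unfold closedBoxRegion
  refine (measurableSet_le measurable_const m2).inter ((measurableSet_le m2 measurable_const).inter
    ((measurableSet_le (hM₁.measurable.comp m2) m1).inter
    ((measurableSet_le m1 (hM₂.measurable.comp m2)).inter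
    ((measurableSet_le mL m0).inter (measurableSet_le m0 mU)))))

/-- The open box sits inside the closed one. [folklore] -/
theorem boxRegion_subset_closedBoxRegion :
    boxRegion α β M₁ M₂ L U ⊆ closedBoxRegion α β M₁ M₂ L U := by
  rintro e ⟨h1, h2, h3, h4, h5, h6⟩
  exact ⟨h1.le, h2.le, h3.le, h4.le, h5.le, h6.le⟩

/-- A one-dimensional integral of an `Ioo`-supported function as an interval integral. [folklore] -/
theorem integral_ite_Ioo {a b : ℝ} (hab : a ≤ b) (g : ℝ → ℝ) :
    ∫ t : ℝ, (if a < t ∧ t < b then g t else 0) = ∫ t in a..b, g t := by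
  have : (fun t : ℝ => if a < t ∧ t < b then g t else 0) = (Ioo a b).indicator g := by
    funext t
    by_cases h : a < t ∧ t < b
    · rw [if_pos h, indicator_of_mem (show t ∈ Ioo a b from h)]
    · rw [if_neg h, indicator_of_notMem (show t ∉ Ioo a b from h)]
  rw [this, integral_indicator measurableSet_Ioo, intervalIntegral.integral_of_le hab,
    integral_Ioc_eq_integral_Ioo]

/-- **Iterated integral over a box region**: for continuous `f` and continuous bounds with
`α ≤ β`, `M₁ ≤ M₂` on `[α, β]` and `L ≤ U` on the middle region, and a bounded region,
`∫_{box} f = ∫_α^β ∫_{M₁ v}^{M₂ v} ∫_{L u v}^{U u v} f(t, u, v) dt du dv`. [folklore] -/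
theorem integral_boxRegion (f : (Fin 3 → ℝ) → ℝ) (hf : Continuous f)
    (hM₁ : Continuous M₁) (hM₂ : Continuous M₂)
    (hL : Continuous (Function.uncurry L)) (hU : Continuous (Function.uncurry U))
    (hαβ : α ≤ β) (hM : ∀ v, α ≤ v → v ≤ β → M₁ v ≤ M₂ v)
    (hLU : ∀ v, α ≤ v → v ≤ β → ∀ u, M₁ v ≤ u → u ≤ M₂ v → L u v ≤ U u v)
    {R : ℝ} (hbound : boxRegion α β M₁ M₂ L U ⊆ Icc (fun _ => -R) (fun _ => R)) :
    ∫ e in boxRegion α β M₁ M₂ L U, f e =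
      ∫ v in α..β, ∫ u in M₁ v..M₂ v, ∫ t in L u v..U u v, f ![t, u, v] := by
  set B := boxRegion α β M₁ M₂ L U with hB
  have hBm : MeasurableSet B := measurableSet_boxRegion hM₁ hM₂ hL hU
  have hint : IntegrableOn f B volume :=
    (hf.continuousOn.integrableOn_compact isCompact_Icc).mono_set hbound
  rw [← integral_indicator hBm, integral_fin3_eq_iterated _ (hint.integrable_indicator hBm)]
  -- the indicator, coordinatewise
  have hind : ∀ t u v : ℝ, B.indicator f ![t, u, v] =
      if α < v ∧ v < β ∧ M₁ v < u ∧ u < M₂ v then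
        (if L u v < t ∧ t < U u v then f ![t, u, v] else 0) else 0 := by
    intro t u v
    by_cases h1 : α < v ∧ v < β ∧ M₁ v < u ∧ u < M₂ v
    · rw [if_pos h1]
      by_cases h2 : L u v < t ∧ t < U u v
      · rw [if_pos h2, indicator_of_mem]
        exact ⟨h1.1, h1.2.1, h1.2.2.1, h1.2.2.2, h2.1, h2.2⟩
      · rw [if_neg h2, indicator_of_notMem]
        rintro ⟨-, -, -, -, h5, h6⟩; exact h2 ⟨h5, h6⟩
    · rw [if_neg h1, indicator_of_notMem]
      rintro ⟨ha, hb, hc, hd, -, -⟩; exact h1 ⟨ha, hb, hc, hd⟩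
  simp_rw [hind]
  -- inner integral
  have hinner : ∀ u v : ℝ, (∫ t : ℝ, if α < v ∧ v < β ∧ M₁ v < u ∧ u < M₂ v then
      (if L u v < t ∧ t < U u v then f ![t, u, v] else 0) else 0) =
      if α < v ∧ v < β ∧ M₁ v < u ∧ u < M₂ v then ∫ t in L u v..U u v, f ![t, u, v] else 0 := by
    intro u v
    by_cases h1 : α < v ∧ v < β ∧ M₁ v < u ∧ u < M₂ v
    · simp only [if_pos h1]
      exact integral_ite_Ioo (hLU v h1.1.le h1.2.1.le u h1.2.2.1.le h1.2.2.2.le) _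
    · simp only [if_neg h1, integral_zero]
  simp_rw [hinner]
  -- middle integral
  have hmiddle : ∀ v : ℝ, (∫ u : ℝ, if α < v ∧ v < β ∧ M₁ v < u ∧ u < M₂ v then
      ∫ t in L u v..U u v, f ![t, u, v] else 0) =
      if α < v ∧ v < β then ∫ u in M₁ v..M₂ v, ∫ t in L u v..U u v, f ![t, u, v] else 0 := by
    intro v
    by_cases h1 : α < v ∧ v < β
    · rw [if_pos h1, ← integral_ite_Ioo (hM v h1.1.le h1.2.le)]
      congr 1; funext u
      by_cases h2 : M₁ v < u ∧ u < M₂ v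
      · rw [if_pos h2, if_pos ⟨h1.1, h1.2, h2.1, h2.2⟩]
      · rw [if_neg h2, if_neg (fun h => h2 ⟨h.2.2.1, h.2.2.2⟩)]
    · rw [if_neg h1]
      have : ∀ u : ℝ, ¬ (α < v ∧ v < β ∧ M₁ v < u ∧ u < M₂ v) := fun u h => h1 ⟨h.1, h.2.1⟩
      simp only [if_neg (this _), integral_zero]
  simp_rw [hmiddle]
  exact integral_ite_Ioo hαβ _

/-! ## B3. Null boundaries -/

/-- A graph `{e₀ = g(e₁, e₂)}` over the last two coordinates is null. [folklore] -/
theorem volume_graph₀ {g : ℝ → ℝ → ℝ} (hg : Measurable (Function.uncurry g)) :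
    volume {e : Fin 3 → ℝ | e 0 = g (e 1) (e 2)} = 0 := by
  have hset : {e : Fin 3 → ℝ | e 0 = g (e 1) (e 2)} =
      fin3Equiv ⁻¹' {p : ℝ × (ℝ × ℝ) | p.1 = g p.2.1 p.2.2} := by
    ext e; simp [fin3Equiv_apply]
  have hS : MeasurableSet {p : ℝ × (ℝ × ℝ) | p.1 = g p.2.1 p.2.2} :=
    measurableSet_eq_fun measurable_fst (hg.comp measurable_snd)
  rw [hset, measurePreserving_fin3Equiv.measure_preimage hS.nullMeasurableSet,
    Measure.volume_eq_prod, Measure.prod_apply_symm hS]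
  have : ∀ q : ℝ × ℝ, volume ((fun x : ℝ => (x, q)) ⁻¹' {p : ℝ × (ℝ × ℝ) | p.1 = g p.2.1 p.2.2}) = 0 := by
    intro q
    have : (fun x : ℝ => (x, q)) ⁻¹' {p : ℝ × (ℝ × ℝ) | p.1 = g p.2.1 p.2.2} = {g q.1 q.2} := by
      ext x; simp
    rw [this]; exact measure_singleton _
  simp_rw [this, lintegral_zero]

/-- A graph `{e₁ = g(e₂)}` is null. [folklore] -/
theorem volume_graph₁ {g : ℝ → ℝ} (hg : Measurable g) :
    volume {e : Fin 3 → ℝ | e 1 = g (e 2)} = 0 := by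
  have hset : {e : Fin 3 → ℝ | e 1 = g (e 2)} =
      fin3Equiv ⁻¹' ((univ : Set ℝ) ×ˢ {q : ℝ × ℝ | q.1 = g q.2}) := by
    ext e; simp [fin3Equiv_apply]
  have hS2 : MeasurableSet {q : ℝ × ℝ | q.1 = g q.2} :=
    measurableSet_eq_fun measurable_fst (hg.comp measurable_snd)
  have hS : MeasurableSet ((univ : Set ℝ) ×ˢ {q : ℝ × ℝ | q.1 = g q.2}) :=
    MeasurableSet.univ.prod hS2
  rw [hset, measurePreserving_fin3Equiv.measure_preimage hS.nullMeasurableSet,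
    Measure.volume_eq_prod, Measure.prod_prod]
  have h2 : volume {q : ℝ × ℝ | q.1 = g q.2} = 0 := by
    rw [Measure.volume_eq_prod, Measure.prod_apply_symm hS2]
    have : ∀ y : ℝ, volume ((fun x : ℝ => (x, y)) ⁻¹' {q : ℝ × ℝ | q.1 = g q.2}) = 0 := by
      intro y
      have : (fun x : ℝ => (x, y)) ⁻¹' {q : ℝ × ℝ | q.1 = g q.2} = {g y} := by ext x; simp
      rw [this]; exact measure_singleton _
    simp_rw [this, lintegral_zero]
  rw [show (volume : Measure (ℝ × ℝ)) {q : ℝ × ℝ | q.1 = g q.2} = 0 from h2, mul_zero]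

/-- A coordinate hyperplane `{e₂ = c}` is null. [folklore] -/
theorem volume_hyperplane₂ (c : ℝ) : volume {e : Fin 3 → ℝ | e 2 = c} = 0 := by
  rw [volume_pi]
  exact Measure.pi_hyperplane (μ := fun _ : Fin 3 => (volume : Measure ℝ)) 2 c

/-- **The boundary of a box region is null**: `vol (closedBox ∖ box) = 0`. [folklore] -/
theorem volume_closedBoxRegion_diff (hM₁ : Continuous M₁) (hM₂ : Continuous M₂)
    (hL : Continuous (Function.uncurry L)) (hU : Continuous (Function.uncurry U)) :
    volume (closedBoxRegion α β M₁ M₂ L U \ boxRegion α β M₁ M₂ L U) = 0 := by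
  have hsub : closedBoxRegion α β M₁ M₂ L U \ boxRegion α β M₁ M₂ L U ⊆
      ({e : Fin 3 → ℝ | e 2 = α} ∪ {e | e 2 = β}) ∪
      (({e : Fin 3 → ℝ | e 1 = M₁ (e 2)} ∪ {e | e 1 = M₂ (e 2)}) ∪
      ({e : Fin 3 → ℝ | e 0 = L (e 1) (e 2)} ∪ {e | e 0 = U (e 1) (e 2)})) := by
    rintro e ⟨⟨h1, h2, h3, h4, h5, h6⟩, hn⟩
    simp only [boxRegion, mem_setOf_eq, not_and, not_lt] at hn
    simp only [mem_union, mem_setOf_eq]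
    by_contra hc
    push Not at hc
    obtain ⟨⟨hc1, hc2⟩, ⟨hc3, hc4⟩, ⟨hc5, hc6⟩⟩ := hc
    have g1 : α < e 2 := lt_of_le_of_ne h1 (Ne.symm hc1)
    have g2 : e 2 < β := lt_of_le_of_ne h2 hc2
    have g3 : M₁ (e 2) < e 1 := lt_of_le_of_ne h3 (Ne.symm hc3)
    have g4 : e 1 < M₂ (e 2) := lt_of_le_of_ne h4 hc4
    have g5 : L (e 1) (e 2) < e 0 := lt_of_le_of_ne h5 (Ne.symm hc5)
    have g6 := hn g1 g2 g3 g4 g5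
    exact hc6 (le_antisymm h6 g6)
  refine measure_mono_null hsub ?_
  refine (measure_union_null (measure_union_null (volume_hyperplane₂ α) (volume_hyperplane₂ β))
    (measure_union_null (measure_union_null (volume_graph₁ hM₁.measurable)
      (volume_graph₁ hM₂.measurable))
      (measure_union_null (volume_graph₀ hL.measurable) (volume_graph₀ hU.measurable))))

/-- Consequently the integrals over the open and the closed box agree. [folklore] -/
theorem setIntegral_closedBoxRegion_eq (f : (Fin 3 → ℝ) → ℝ) (hM₁ : Continuous M₁)
    (hM₂ : Continuous M₂) (hL : Continuous (Function.uncurry L))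
    (hU : Continuous (Function.uncurry U)) :
    ∫ e in closedBoxRegion α β M₁ M₂ L U, f e = ∫ e in boxRegion α β M₁ M₂ L U, f e :=
  (setIntegral_congr_set (ae_eq_set.mpr ⟨by
    rw [Set.sdiff_eq_empty.mpr boxRegion_subset_closedBoxRegion]; exact measure_empty,
    volume_closedBoxRegion_diff hM₁ hM₂ hL hU⟩)).symm

/-! ## B4. The second nesting: outer `e 1`, middle `e 2`, inner `e 0` -/

/-- The open region `{α < e₁ < β, M₁ e₁ < e₂ < M₂ e₁, L e₂ e₁ < e₀ < U e₂ e₁}`. [folklore] -/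
def boxRegion' (α β : ℝ) (M₁ M₂ : ℝ → ℝ) (L U : ℝ → ℝ → ℝ) : Set (Fin 3 → ℝ) :=
  {e | α < e 1 ∧ e 1 < β ∧ M₁ (e 1) < e 2 ∧ e 2 < M₂ (e 1) ∧
    L (e 2) (e 1) < e 0 ∧ e 0 < U (e 2) (e 1)}

/-- The closed version of `boxRegion'`. [folklore] -/
def closedBoxRegion' (α β : ℝ) (M₁ M₂ : ℝ → ℝ) (L U : ℝ → ℝ → ℝ) : Set (Fin 3 → ℝ) :=
  {e | α ≤ e 1 ∧ e 1 ≤ β ∧ M₁ (e 1) ≤ e 2 ∧ e 2 ≤ M₂ (e 1) ∧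
    L (e 2) (e 1) ≤ e 0 ∧ e 0 ≤ U (e 2) (e 1)}

/-- `boxRegion'` is measurable (for continuous bounds). [folklore] -/
theorem measurableSet_boxRegion' (hM₁ : Continuous M₁) (hM₂ : Continuous M₂)
    (hL : Continuous (Function.uncurry L)) (hU : Continuous (Function.uncurry U)) :
    MeasurableSet (boxRegion' α β M₁ M₂ L U) := by
  have m0 : Measurable fun e : Fin 3 → ℝ => e 0 := measurable_pi_apply 0
  have m1 : Measurable fun e : Fin 3 → ℝ => e 1 := measurable_pi_apply 1
  have m2 : Measurable fun e : Fin 3 → ℝ => e 2 := measurable_pi_apply 2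
  have mL : Measurable fun e : Fin 3 → ℝ => L (e 2) (e 1) :=
    hL.measurable.comp (m2.prodMk m1)
  have mU : Measurable fun e : Fin 3 → ℝ => U (e 2) (e 1) :=
    hU.measurable.comp (m2.prodMk m1)
  unfold boxRegion'
  refine (measurableSet_lt measurable_const m1).inter ((measurableSet_lt m1 measurable_const).inter
    ((measurableSet_lt (hM₁.measurable.comp m1) m2).inter
    ((measurableSet_lt m2 (hM₂.measurable.comp m1)).inter
    ((measurableSet_lt mL m0).inter (measurableSet_lt m0 mU)))))

/-- `closedBoxRegion'` is measurable (for continuous bounds). [folklore] -/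
theorem measurableSet_closedBoxRegion' (hM₁ : Continuous M₁) (hM₂ : Continuous M₂)
    (hL : Continuous (Function.uncurry L)) (hU : Continuous (Function.uncurry U)) :
    MeasurableSet (closedBoxRegion' α β M₁ M₂ L U) := by
  have m0 : Measurable fun e : Fin 3 → ℝ => e 0 := measurable_pi_apply 0
  have m1 : Measurable fun e : Fin 3 → ℝ => e 1 := measurable_pi_apply 1
  have m2 : Measurable fun e : Fin 3 → ℝ => e 2 := measurable_pi_apply 2
  have mL : Measurable fun e : Fin 3 → ℝ => L (e 2) (e 1) :=
    hL.measurable.comp (m2.prodMk m1)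
  have mU : Measurable fun e : Fin 3 → ℝ => U (e 2) (e 1) :=
    hU.measurable.comp (m2.prodMk m1)
  unfold closedBoxRegion'
  refine (measurableSet_le measurable_const m1).inter ((measurableSet_le m1 measurable_const).inter
    ((measurableSet_le (hM₁.measurable.comp m1) m2).inter
    ((measurableSet_le m2 (hM₂.measurable.comp m1)).inter
    ((measurableSet_le mL m0).inter (measurableSet_le m0 mU)))))

/-- The open primed box sits inside the closed one. [folklore] -/
theorem boxRegion'_subset_closedBoxRegion' :
    boxRegion' α β M₁ M₂ L U ⊆ closedBoxRegion' α β M₁ M₂ L U := by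
  rintro e ⟨h1, h2, h3, h4, h5, h6⟩
  exact ⟨h1.le, h2.le, h3.le, h4.le, h5.le, h6.le⟩

/-- **Iterated integral over a primed box region** (outer `e₁`, middle `e₂`, inner `e₀`):
`∫_{box'} f = ∫_α^β ∫_{M₁ v}^{M₂ v} ∫_{L u v}^{U u v} f(t, v, u) dt du dv`. [folklore] -/
theorem integral_boxRegion' (f : (Fin 3 → ℝ) → ℝ) (hf : Continuous f)
    (hM₁ : Continuous M₁) (hM₂ : Continuous M₂)
    (hL : Continuous (Function.uncurry L)) (hU : Continuous (Function.uncurry U))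
    (hαβ : α ≤ β) (hM : ∀ v, α ≤ v → v ≤ β → M₁ v ≤ M₂ v)
    (hLU : ∀ v, α ≤ v → v ≤ β → ∀ u, M₁ v ≤ u → u ≤ M₂ v → L u v ≤ U u v)
    {R : ℝ} (hbound : boxRegion' α β M₁ M₂ L U ⊆ Icc (fun _ => -R) (fun _ => R)) :
    ∫ e in boxRegion' α β M₁ M₂ L U, f e =
      ∫ v in α..β, ∫ u in M₁ v..M₂ v, ∫ t in L u v..U u v, f ![t, v, u] := by
  set B := boxRegion' α β M₁ M₂ L U with hB
  have hBm : MeasurableSet B := measurableSet_boxRegion' hM₁ hM₂ hL hU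
  have hint : IntegrableOn f B volume :=
    (hf.continuousOn.integrableOn_compact isCompact_Icc).mono_set hbound
  rw [← integral_indicator hBm, integral_fin3_eq_iterated' _ (hint.integrable_indicator hBm)]
  -- the indicator, coordinatewise: here `u = e 1` (outer) and `v = e 2` (middle)
  have hind : ∀ t u v : ℝ, B.indicator f ![t, u, v] =
      if α < u ∧ u < β ∧ M₁ u < v ∧ v < M₂ u then
        (if L v u < t ∧ t < U v u then f ![t, u, v] else 0) else 0 := by
    intro t u v
    by_cases h1 : α < u ∧ u < β ∧ M₁ u < v ∧ v < M₂ u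
    · rw [if_pos h1]
      by_cases h2 : L v u < t ∧ t < U v u
      · rw [if_pos h2, indicator_of_mem]
        exact ⟨h1.1, h1.2.1, h1.2.2.1, h1.2.2.2, h2.1, h2.2⟩
      · rw [if_neg h2, indicator_of_notMem]
        rintro ⟨-, -, -, -, h5, h6⟩; exact h2 ⟨h5, h6⟩
    · rw [if_neg h1, indicator_of_notMem]
      rintro ⟨ha, hb, hc, hd, -, -⟩; exact h1 ⟨ha, hb, hc, hd⟩
  simp_rw [hind]
  have hinner : ∀ u v : ℝ, (∫ t : ℝ, if α < u ∧ u < β ∧ M₁ u < v ∧ v < M₂ u then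
      (if L v u < t ∧ t < U v u then f ![t, u, v] else 0) else 0) =
      if α < u ∧ u < β ∧ M₁ u < v ∧ v < M₂ u then ∫ t in L v u..U v u, f ![t, u, v] else 0 := by
    intro u v
    by_cases h1 : α < u ∧ u < β ∧ M₁ u < v ∧ v < M₂ u
    · simp only [if_pos h1]
      exact integral_ite_Ioo (hLU u h1.1.le h1.2.1.le v h1.2.2.1.le h1.2.2.2.le) _
    · simp only [if_neg h1, integral_zero]
  simp_rw [hinner]
  have hmiddle : ∀ u : ℝ, (∫ v : ℝ, if α < u ∧ u < β ∧ M₁ u < v ∧ v < M₂ u then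
      ∫ t in L v u..U v u, f ![t, u, v] else 0) =
      if α < u ∧ u < β then ∫ v in M₁ u..M₂ u, ∫ t in L v u..U v u, f ![t, u, v] else 0 := by
    intro u
    by_cases h1 : α < u ∧ u < β
    · rw [if_pos h1, ← integral_ite_Ioo (hM u h1.1.le h1.2.le)]
      congr 1; funext v
      by_cases h2 : M₁ u < v ∧ v < M₂ u
      · rw [if_pos h2, if_pos ⟨h1.1, h1.2, h2.1, h2.2⟩]
      · rw [if_neg h2, if_neg (fun h => h2 ⟨h.2.2.1, h.2.2.2⟩)]
    · rw [if_neg h1]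
      have : ∀ v : ℝ, ¬ (α < u ∧ u < β ∧ M₁ u < v ∧ v < M₂ u) := fun v h => h1 ⟨h.1, h.2.1⟩
      simp only [if_neg (this _), integral_zero]
  simp_rw [hmiddle]
  exact integral_ite_Ioo hαβ _

/-- A graph `{e₂ = g(e₁)}` is null. [folklore] -/
theorem volume_graph₂ {g : ℝ → ℝ} (hg : Measurable g) :
    volume {e : Fin 3 → ℝ | e 2 = g (e 1)} = 0 := by
  have hset : {e : Fin 3 → ℝ | e 2 = g (e 1)} =
      fin3Equiv ⁻¹' ((univ : Set ℝ) ×ˢ {q : ℝ × ℝ | q.2 = g q.1}) := by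
    ext e; simp [fin3Equiv_apply]
  have hS2 : MeasurableSet {q : ℝ × ℝ | q.2 = g q.1} :=
    measurableSet_eq_fun measurable_snd (hg.comp measurable_fst)
  have hS : MeasurableSet ((univ : Set ℝ) ×ˢ {q : ℝ × ℝ | q.2 = g q.1}) :=
    MeasurableSet.univ.prod hS2
  rw [hset, measurePreserving_fin3Equiv.measure_preimage hS.nullMeasurableSet,
    Measure.volume_eq_prod, Measure.prod_prod]
  have h2 : volume {q : ℝ × ℝ | q.2 = g q.1} = 0 := by
    rw [Measure.volume_eq_prod, Measure.prod_apply hS2]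
    have : ∀ x : ℝ, volume (Prod.mk x ⁻¹' {q : ℝ × ℝ | q.2 = g q.1}) = 0 := by
      intro x
      have : Prod.mk x ⁻¹' {q : ℝ × ℝ | q.2 = g q.1} = {g x} := by ext y; simp
      rw [this]; exact measure_singleton _
    simp_rw [this, lintegral_zero]
  rw [show (volume : Measure (ℝ × ℝ)) {q : ℝ × ℝ | q.2 = g q.1} = 0 from h2, mul_zero]

/-- A coordinate hyperplane `{e₁ = c}` is null. [folklore] -/
theorem volume_hyperplane₁ (c : ℝ) : volume {e : Fin 3 → ℝ | e 1 = c} = 0 := by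
  rw [volume_pi]
  exact Measure.pi_hyperplane (μ := fun _ : Fin 3 => (volume : Measure ℝ)) 1 c

/-- **The boundary of a primed box region is null.** [folklore] -/
theorem volume_closedBoxRegion'_diff (hM₁ : Continuous M₁) (hM₂ : Continuous M₂)
    (hL : Continuous (Function.uncurry L)) (hU : Continuous (Function.uncurry U)) :
    volume (closedBoxRegion' α β M₁ M₂ L U \ boxRegion' α β M₁ M₂ L U) = 0 := by
  have hsub : closedBoxRegion' α β M₁ M₂ L U \ boxRegion' α β M₁ M₂ L U ⊆
      ({e : Fin 3 → ℝ | e 1 = α} ∪ {e | e 1 = β}) ∪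
      (({e : Fin 3 → ℝ | e 2 = M₁ (e 1)} ∪ {e | e 2 = M₂ (e 1)}) ∪
      ({e : Fin 3 → ℝ | e 0 = L (e 2) (e 1)} ∪ {e | e 0 = U (e 2) (e 1)})) := by
    rintro e ⟨⟨h1, h2, h3, h4, h5, h6⟩, hn⟩
    simp only [boxRegion', mem_setOf_eq, not_and, not_lt] at hn
    simp only [mem_union, mem_setOf_eq]
    by_contra hc
    push Not at hc
    obtain ⟨⟨hc1, hc2⟩, ⟨hc3, hc4⟩, ⟨hc5, hc6⟩⟩ := hc
    have g1 : α < e 1 := lt_of_le_of_ne h1 (Ne.symm hc1)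
    have g2 : e 1 < β := lt_of_le_of_ne h2 hc2
    have g3 : M₁ (e 1) < e 2 := lt_of_le_of_ne h3 (Ne.symm hc3)
    have g4 : e 2 < M₂ (e 1) := lt_of_le_of_ne h4 hc4
    have g5 : L (e 2) (e 1) < e 0 := lt_of_le_of_ne h5 (Ne.symm hc5)
    have g6 := hn g1 g2 g3 g4 g5
    exact hc6 (le_antisymm h6 g6)
  refine measure_mono_null hsub ?_
  have hL' : Measurable (Function.uncurry fun (a b : ℝ) => L b a) :=
    hL.measurable.comp (measurable_snd.prodMk measurable_fst)
  have hU' : Measurable (Function.uncurry fun (a b : ℝ) => U b a) :=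
    hU.measurable.comp (measurable_snd.prodMk measurable_fst)
  refine (measure_union_null (measure_union_null (volume_hyperplane₁ α) (volume_hyperplane₁ β))
    (measure_union_null (measure_union_null (volume_graph₂ hM₁.measurable)
      (volume_graph₂ hM₂.measurable))
      (measure_union_null (volume_graph₀ hL') (volume_graph₀ hU'))))

/-- Consequently the integrals over the open and the closed primed box agree. [folklore] -/
theorem setIntegral_closedBoxRegion'_eq (f : (Fin 3 → ℝ) → ℝ) (hM₁ : Continuous M₁)
    (hM₂ : Continuous M₂) (hL : Continuous (Function.uncurry L))
    (hU : Continuous (Function.uncurry U)) :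
    ∫ e in closedBoxRegion' α β M₁ M₂ L U, f e = ∫ e in boxRegion' α β M₁ M₂ L U, f e :=
  (setIntegral_congr_set (ae_eq_set.mpr ⟨by
    rw [Set.sdiff_eq_empty.mpr boxRegion'_subset_closedBoxRegion']; exact measure_empty,
    volume_closedBoxRegion'_diff hM₁ hM₂ hL hU⟩)).symm

end ZhangJiangXie2025

end Literature.Probability.RandomMatrix

end
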